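import Summits.MatrixMultiplication.MatrixMultiplication.Theorems.SnSubsetDichotomyHyperoctahedralThresholdCleanReflection
import Summits.MatrixMultiplication.MatrixMultiplication.Theorems.SnSubsetDichotomyHyperoctahedralThresholdFrameCycles

/-!
# Arc reflection structures on a frame cycle (crux `HyperoctahedralThreshold`, stmt-MatrixMultiplication-10883)

Part 2/3 of the thin-walk lemma (G1) of crux NOTES §B (`stub_thinCleanWalk`, Theorems/…ThinCleanWalk.lean), in the
setting of Theorems/…FrameCycles.lean: `X` the alternating walk of the frame `M₀ ∪ M₁` (`X (t+1) = μ (e t) (X t)`,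
`(e t).val = t % 2`) with least period `T`.  Two ways an arc of the cycle closes up into a CLEAN reflection
structure, hence — by the tree's `cleanReflection_walk` (Theorems/…CleanReflection.lean) — into closed-rung-walk
data in the conclusion format of the line's open core `stub_poorRigidCore` (no forbidden set):
* `ThinWalk.shapeI` (registered as `stub_arcReflectionWalk`): a colour `c ≠ e i` pairing `X i` with `X (i + 2t₀ + 1)`
  (`2t₀ + 1 < T`) — a bichromatic chord (`c = 2`), or the frame edge behind `X 1` (`i = 1`, `c = e 0`,
  `2t₀ + 2 = T`: the whole bicoloured cycle) — gives the structure `(X i; c, [e i, …, e (i+t₀-1)], e (i+t₀))`: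
  both ends walk towards each other along the arc and meet at an edge; `k + 1 = 2t₀ + 2` rungs, all walk points among
  the `2t₀ + 2` arc points;
* `ThinWalk.shapeII`: the frame edge `{X s, X (s+1)}` carried by colour `2` onto a rung `{X i, X (i + 2t₀ + 1)}`
  further along the cycle (`s + 2 ≤ i`, `i + 2t₀ + 1 < s + T`) whose ends then converge: `k + 1 = 2t₀ + 4`, all walk
  points among the `2t₀ + 4` structure points (so supports are as thin as the rung counts).
Cleanness = the structure's points are points of the walk at pairwise distinct times in one window of length `T`
(`ThinWalk.clean_of_idx`).  Pure finite combinatorics, no definitions. [this line; folklore]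
-/

set_option linter.dupNamespace false

namespace Summit.MatrixMultiplication.MatrixMultiplication.Theorems.HyperoctahedralThreshold

open Equiv

namespace ThinWalk

variable {n : ℕ}

/-! ### Trajectories along an arc of the cycle, and cleanness from distinct indices -/

section Traj

variable (μ : Fin 3 → Perm (Fin n)) (e : ℕ → Fin 3) (X : ℕ → Fin n) (i t₀ : ℕ)

/-- Forward trajectory: reading the arc colours `e i, e (i+1), …` from `X i` walks forward along the cycle. -/
theorem traj_fwd (hX : ∀ t, X (t + 1) = μ (e t) (X t)) : ∀ t ≤ t₀,
    (((List.range t₀).map (fun k => e (i + k))).take t).foldl (fun v c => μ c v) (X i) = X (i + t) := by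
  intro t
  induction t with
  | zero => intro; simp
  | succ t ih =>
    intro ht
    rw [List.take_succ_eq_append_getElem (by simpa using ht), List.foldl_append, ih (by omega),
      List.foldl_cons, List.foldl_nil]
    simp only [List.getElem_map, List.getElem_range]
    rw [show i + (t + 1) = (i + t) + 1 by omega, hX]

/-- Backward trajectory: reading the same colours from `X (i + 2 t₀ + 1)` walks backward along the cycle. -/
theorem traj_bwd (hμ : ∀ c, μ c * μ c = 1) (he : ∀ t, (e t).val = t % 2)
    (hX : ∀ t, X (t + 1) = μ (e t) (X t)) : ∀ t ≤ t₀,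
    (((List.range t₀).map (fun k => e (i + k))).take t).foldl (fun v c => μ c v) (X (i + 2 * t₀ + 1)) =
      X (i + 2 * t₀ + 1 - t) := by
  intro t
  induction t with
  | zero => intro; simp
  | succ t ih =>
    intro ht
    rw [List.take_succ_eq_append_getElem (by simpa using ht), List.foldl_append, ih (by omega),
      List.foldl_cons, List.foldl_nil]
    simp only [List.getElem_map, List.getElem_range]
    rw [show i + 2 * t₀ + 1 - t = (i + 2 * t₀ - t) + 1 by omega,
      show i + 2 * t₀ + 1 - (t + 1) = i + 2 * t₀ - t by omega,
      e_eq_of_mod e he (show (i + t) % 2 = (i + 2 * t₀ - t) % 2 by omega), back μ e X hμ hX]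

/-- The arc word is a reduced colour word. -/
theorem conv_isChain (he : ∀ t, (e t).val = t % 2) :
    List.IsChain (· ≠ ·) ((List.range t₀).map (fun k => e (i + k))) := by
  rw [List.isChain_map, List.isChain_range]
  intro m _
  rw [Nat.succ_eq_add_one, ← Nat.add_assoc]
  exact e_ne_succ e he (i + m)

end Traj

/-- **Cleanness from indices.**  If the two sides of the rungs are points of the walk at indices lying in one window
of length `T`, pairwise distinct across and along the sides, the rungs are pairwise equal (same time) or disjoint. -/
theorem clean_of_idx (X : ℕ → Fin n) (T w m : ℕ)
    (hwin : ∀ a b : ℕ, a ≠ b → a < b + T → b < a + T → X a ≠ X b)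
    (P Q : ℕ → Fin n) (φ ψ : ℕ → ℕ) (hP : ∀ t ≤ m, P t = X (φ t)) (hQ : ∀ t ≤ m, Q t = X (ψ t))
    (hφ : ∀ t ≤ m, w ≤ φ t ∧ φ t < w + T) (hψ : ∀ t ≤ m, w ≤ ψ t ∧ ψ t < w + T)
    (hφi : ∀ s ≤ m, ∀ t ≤ m, φ s = φ t → s = t) (hψi : ∀ s ≤ m, ∀ t ≤ m, ψ s = ψ t → s = t)
    (hφψ : ∀ s ≤ m, ∀ t ≤ m, φ s ≠ ψ t) :
    ∀ s ≤ m, ∀ t ≤ m, (P s = P t ∧ Q s = Q t) ∨ (P s = Q t ∧ Q s = P t) ∨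
      (P s ≠ P t ∧ P s ≠ Q t ∧ Q s ≠ P t ∧ Q s ≠ Q t) := by
  intro s hs t ht
  by_cases hst : s = t
  · subst hst; exact Or.inl ⟨rfl, rfl⟩
  · right; right
    rw [hP s hs, hP t ht, hQ s hs, hQ t ht]
    obtain ⟨h1, h2⟩ := hφ s hs
    obtain ⟨h3, h4⟩ := hφ t ht
    obtain ⟨h5, h6⟩ := hψ s hs
    obtain ⟨h7, h8⟩ := hψ t ht
    exact ⟨hwin _ _ (fun h => hst (hφi s hs t ht h)) (by omega) (by omega),
      hwin _ _ (hφψ s hs t ht) (by omega) (by omega),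
      hwin _ _ (fun h => hφψ t ht s hs h.symm) (by omega) (by omega),
      hwin _ _ (fun h => hst (hψi s hs t ht h)) (by omega) (by omega)⟩

/-- **Shape I (chord or edge, plus an arc).**  If a colour `c` (not the first arc colour) pairs `X i` with
`X (i + 2 t₀ + 1)` and `2 t₀ + 1 < T`, the reflection structure `(X i; c, [e i, …, e (i + t₀ - 1)], e (i + t₀))`
— the two ends converge along the arc and meet at an edge of colour `e (i + t₀)` — is clean, and gives core-format
closed-rung-walk data with `k + 1 = 2 t₀ + 2` rungs.  (Bicoloured cycle: `i = 1`, `c = e 0`, `2 t₀ + 2 = T`;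
bichromatic chord: `c = 2`.) -/
theorem shapeI (μ : Fin 3 → Perm (Fin n)) (e : ℕ → Fin 3) (X : ℕ → Fin n) (T : ℕ) (hμ : ∀ c, μ c * μ c = 1)
    (hfpf : ∀ c v, μ c v ≠ v) (he : ∀ t, (e t).val = t % 2) (hX : ∀ t, X (t + 1) = μ (e t) (X t))
    (hT0 : 0 < T) (hTX : X T = X 0) (hTmin : ∀ t, 0 < t → X t = X 0 → T ≤ t) (i t₀ : ℕ) (c : Fin 3)
    (hc : c ≠ e i) (hci : μ c (X i) = X (i + 2 * t₀ + 1)) (hwinT : 2 * t₀ + 1 < T) :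
    ∃ (k : ℕ) (p q : Fin (k + 1) → Fin n) (col : Fin (k + 1) → Fin 3), (∀ i, p i ≠ q i) ∧
      (∀ i, (μ (col i) (p i) = p (i + 1) ∧ μ (col i) (q i) = q (i + 1)) ∨
        (μ (col i) (p i) = q (i + 1) ∧ μ (col i) (q i) = p (i + 1))) ∧
      (∀ i, col i ≠ col (i + 1)) ∧
      (∀ i j, (p i = p j ∧ q i = q j) ∨ (p i = q j ∧ q i = p j) ∨
        (p i ≠ p j ∧ p i ≠ q j ∧ q i ≠ p j ∧ q i ≠ q j)) ∧
      (∀ i', p i' ∈ (Finset.range (2 * t₀ + 2)).image (fun j => X (i + j)) ∧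
        q i' ∈ (Finset.range (2 * t₀ + 2)).image (fun j => X (i + j))) ∧ k + 1 = 2 * t₀ + 2 := by
  obtain ⟨g, hg⟩ : ∃ g : List (Fin 3), g = (List.range t₀).map (fun k => e (i + k)) := ⟨_, rfl⟩
  have hlen : g.length = t₀ := by rw [hg]; simp
  have hwin := ne_of_window μ e X T hμ hfpf he hX hT0 hTX hTmin
  have hf : ∀ t ≤ t₀, (g.take t).foldl (fun v c => μ c v) (X i) = X (i + t) := by
    rw [hg]; exact traj_fwd μ e X i t₀ hX
  have hb : ∀ t ≤ t₀, (g.take t).foldl (fun v c => μ c v) (μ c (X i)) = X (i + 2 * t₀ + 1 - t) := by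
    intro t ht; rw [hci, hg]; exact traj_bwd μ e X i t₀ hμ he hX t ht
  have hget : ∀ (t : ℕ) (x : Fin 3), g[t]? = some x → t < t₀ ∧ x = e (i + t) := by
    intro t x hx
    rw [hg, List.getElem?_map] at hx
    by_cases ht : t < t₀
    · rw [List.getElem?_range ht, Option.map_some, Option.some.injEq] at hx
      exact ⟨ht, hx.symm⟩
    · rw [List.getElem?_eq_none (by simp; omega), Option.map_none] at hx
      exact absurd hx (by simp)
  have hhead : ∀ x ∈ g.head?, x ≠ c := by
    intro x hx
    rw [Option.mem_def, List.head?_eq_getElem?] at hx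
    obtain ⟨-, rfl⟩ := hget 0 x hx
    rw [Nat.add_zero]
    exact fun h => hc h.symm
  have hlast : ∀ x ∈ g.getLast?, x ≠ e (i + t₀) := by
    intro x hx
    rw [Option.mem_def, List.getLast?_eq_getElem?, hlen] at hx
    obtain ⟨hlt, rfl⟩ := hget _ x hx
    have := e_ne_succ e he (i + (t₀ - 1))
    rwa [show i + (t₀ - 1) + 1 = i + t₀ by omega] at this
  have hnil : g = [] → c ≠ e (i + t₀) := by
    intro h
    have : t₀ = 0 := by rw [← hlen, h, List.length_nil]
    subst this
    simpa using hc
  have hinc : μ (e (i + t₀)) (g.foldl (fun v c => μ c v) (X i)) = g.foldl (fun v c => μ c v) (μ c (X i)) := by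
    have hf' := hf t₀ le_rfl
    have hb' := hb t₀ le_rfl
    rw [List.take_of_length_le (by rw [hlen])] at hf' hb'
    rw [hf', hb', show i + 2 * t₀ + 1 - t₀ = (i + t₀) + 1 by omega, hX (i + t₀)]
  -- cleanness: all `2 t₀ + 2` points are distinct points of the cycle
  have hclean := clean_of_idx X T i t₀ hwin (fun t => (g.take t).foldl (fun v c => μ c v) (X i))
    (fun t => (g.take t).foldl (fun v c => μ c v) (μ c (X i))) (fun t => i + t) (fun t => i + 2 * t₀ + 1 - t)
    hf hb (fun t ht => by constructor <;> omega) (fun t ht => by constructor <;> omega)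
    (fun s hs t ht h => by omega) (fun s hs t ht h => by omega) (fun s hs t ht => by omega)
  rw [← hlen] at hclean
  -- the points of the structure: the arc `X i, …, X (i + 2 t₀ + 1)` (used as the complement of the forbidden set)
  have hR : ∀ t ≤ g.length, (g.take t).foldl (fun v c => μ c v) (X i) ∉ ((Finset.range (2 * t₀ + 2)).image
      (fun j => X (i + j)))ᶜ ∧ (g.take t).foldl (fun v c => μ c v) (μ c (X i)) ∉ ((Finset.range (2 * t₀ + 2)).image
      (fun j => X (i + j)))ᶜ := by
    intro t ht
    rw [hlen] at ht
    rw [Finset.mem_compl, Finset.mem_compl, not_not, not_not, hf t ht, hb t ht]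
    exact ⟨Finset.mem_image.2 ⟨t, Finset.mem_range.2 (by omega), rfl⟩,
      Finset.mem_image.2 ⟨2 * t₀ + 1 - t, Finset.mem_range.2 (by omega),
        by rw [show i + (2 * t₀ + 1 - t) = i + 2 * t₀ + 1 - t by omega]⟩⟩
  obtain ⟨k, p, q, col, h1, h2, h3, h4, h5, hk⟩ := cleanReflection_walk n μ hμ _ c (e (i + t₀)) (X i) g
    (hfpf c (X i)) (by rw [hg]; exact conv_isChain e i t₀ he) hhead hlast hnil hinc hclean hR
  simp only [Finset.mem_compl, not_not] at h5
  exact ⟨k, p, q, col, h1, h2, h3, h4, h5, by rw [hk, hlen]⟩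

/-- **Shape II (an edge and its two chords, converging).**  The frame edge `{X ι, X ι'} = {X s, X (s+1)}` (colour
`c = e s`) is carried by colour `2` onto the rung `{X i, X (i + 2 t₀ + 1)}` further along the cycle
(`s + 2 ≤ i`, `i + 2 t₀ + 1 < s + T`), whose ends converge along the arc: the reflection structure
`(X ι; c, 2 :: [e i, …, e (i + t₀ - 1)], e (i + t₀))` is clean and gives core-format data with `k + 1 = 2 t₀ + 4`. -/
theorem shapeII (μ : Fin 3 → Perm (Fin n)) (e : ℕ → Fin 3) (X : ℕ → Fin n) (T : ℕ) (hμ : ∀ c, μ c * μ c = 1)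
    (hfpf : ∀ c v, μ c v ≠ v) (he : ∀ t, (e t).val = t % 2) (hX : ∀ t, X (t + 1) = μ (e t) (X t))
    (hT0 : 0 < T) (hTX : X T = X 0) (hTmin : ∀ t, 0 < t → X t = X 0 → T ≤ t) (s i t₀ ι ι' : ℕ) (c : Fin 3)
    (hc2 : c ≠ 2) (hca : μ c (X ι) = X ι') (hι : s ≤ ι ∧ ι ≤ s + 1) (hι' : s ≤ ι' ∧ ι' ≤ s + 1) (hιι' : ι ≠ ι')
    (h2 : μ 2 (X ι) = X i) (h2' : μ 2 (X ι') = X (i + 2 * t₀ + 1)) (hsi : s + 2 ≤ i)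
    (hwinT : i + 2 * t₀ + 1 < s + T) :
    ∃ (k : ℕ) (p q : Fin (k + 1) → Fin n) (col : Fin (k + 1) → Fin 3), (∀ i, p i ≠ q i) ∧
      (∀ i, (μ (col i) (p i) = p (i + 1) ∧ μ (col i) (q i) = q (i + 1)) ∨
        (μ (col i) (p i) = q (i + 1) ∧ μ (col i) (q i) = p (i + 1))) ∧
      (∀ i, col i ≠ col (i + 1)) ∧
      (∀ i j, (p i = p j ∧ q i = q j) ∨ (p i = q j ∧ q i = p j) ∨
        (p i ≠ p j ∧ p i ≠ q j ∧ q i ≠ p j ∧ q i ≠ q j)) ∧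
      (∀ i', p i' ∈ insert (X s) (insert (X (s + 1)) ((Finset.range (2 * t₀ + 2)).image (fun j => X (i + j)))) ∧
        q i' ∈ insert (X s) (insert (X (s + 1)) ((Finset.range (2 * t₀ + 2)).image (fun j => X (i + j))))) ∧
      k + 1 = 2 * t₀ + 4 := by
  obtain ⟨g, hg⟩ : ∃ g : List (Fin 3), g = (List.range t₀).map (fun k => e (i + k)) := ⟨_, rfl⟩
  have hlen : g.length = t₀ := by rw [hg]; simp
  have hwin := ne_of_window μ e X T hμ hfpf he hX hT0 hTX hTmin
  have hf : ∀ t ≤ t₀, (g.take t).foldl (fun v c => μ c v) (μ 2 (X ι)) = X (i + t) := by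
    intro t ht; rw [h2, hg]; exact traj_fwd μ e X i t₀ hX t ht
  have hb : ∀ t ≤ t₀, (g.take t).foldl (fun v c => μ c v) (μ 2 (μ c (X ι))) = X (i + 2 * t₀ + 1 - t) := by
    intro t ht; rw [hca, h2', hg]; exact traj_bwd μ e X i t₀ hμ he hX t ht
  have hget : ∀ (t : ℕ) (x : Fin 3), g[t]? = some x → t < t₀ ∧ x = e (i + t) := by
    intro t x hx
    rw [hg, List.getElem?_map] at hx
    by_cases ht : t < t₀
    · rw [List.getElem?_range ht, Option.map_some, Option.some.injEq] at hx
      exact ⟨ht, hx.symm⟩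
    · rw [List.getElem?_eq_none (by simp; omega), Option.map_none] at hx
      exact absurd hx (by simp)
  have hP : ∀ t ≤ t₀ + 1, ((2 :: g).take t).foldl (fun v c => μ c v) (X ι) =
      X (if t = 0 then ι else i + (t - 1)) := by
    intro t ht
    cases t with
    | zero => simp
    | succ t =>
      rw [List.take_succ_cons, List.foldl_cons, if_neg (by omega), Nat.add_sub_cancel]
      exact hf t (by omega)
  have hQ : ∀ t ≤ t₀ + 1, ((2 :: g).take t).foldl (fun v c => μ c v) (μ c (X ι)) =
      X (if t = 0 then ι' else i + 2 * t₀ + 1 - (t - 1)) := by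
    intro t ht
    cases t with
    | zero => simp [hca]
    | succ t =>
      rw [List.take_succ_cons, List.foldl_cons, if_neg (by omega), Nat.add_sub_cancel]
      exact hb t (by omega)
  have hv : List.IsChain (· ≠ ·) (2 :: g) := by
    refine List.IsChain.cons (by rw [hg]; exact conv_isChain e i t₀ he) ?_
    intro x hx
    rw [Option.mem_def, List.head?_eq_getElem?] at hx
    obtain ⟨-, rfl⟩ := hget 0 x hx
    exact (e_ne_two e he _).symm
  have hhead : ∀ x ∈ (2 :: g).head?, x ≠ c := by
    intro x hx
    simp only [List.head?_cons, Option.mem_def, Option.some.injEq] at hx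
    subst hx
    exact hc2.symm
  have hlast : ∀ x ∈ (2 :: g).getLast?, x ≠ e (i + t₀) := by
    intro x hx
    rw [Option.mem_def, List.getLast?_eq_getElem?, List.length_cons, hlen, Nat.add_sub_cancel] at hx
    rcases Nat.eq_zero_or_pos t₀ with ht | ht
    · rw [ht, List.getElem?_cons_zero, Option.some.injEq] at hx
      rw [← hx, ht]
      exact (e_ne_two e he _).symm
    · obtain ⟨t, rfl⟩ : ∃ t, t₀ = t + 1 := ⟨t₀ - 1, by omega⟩
      rw [List.getElem?_cons_succ] at hx
      obtain ⟨-, rfl⟩ := hget t x hx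
      rw [← Nat.add_assoc]
      exact e_ne_succ e he (i + t)
  have hinc : μ (e (i + t₀)) ((2 :: g).foldl (fun v c => μ c v) (X ι)) =
      (2 :: g).foldl (fun v c => μ c v) (μ c (X ι)) := by
    have hf' := hf t₀ le_rfl
    have hb' := hb t₀ le_rfl
    rw [List.take_of_length_le (by rw [hlen])] at hf' hb'
    rw [List.foldl_cons, List.foldl_cons]
    show μ (e (i + t₀)) (g.foldl (fun v c => μ c v) (μ 2 (X ι))) = g.foldl (fun v c => μ c v) (μ 2 (μ c (X ι)))
    rw [hf', hb', show i + 2 * t₀ + 1 - t₀ = (i + t₀) + 1 by omega, hX (i + t₀)]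
  obtain ⟨hι1, hι2⟩ := hι
  obtain ⟨hι3, hι4⟩ := hι'
  have hclean := clean_of_idx X T s (t₀ + 1) hwin (fun t => ((2 :: g).take t).foldl (fun v c => μ c v) (X ι))
    (fun t => ((2 :: g).take t).foldl (fun v c => μ c v) (μ c (X ι)))
    (fun t => if t = 0 then ι else i + (t - 1)) (fun t => if t = 0 then ι' else i + 2 * t₀ + 1 - (t - 1))
    hP hQ (fun t ht => by split_ifs <;> constructor <;> omega) (fun t ht => by split_ifs <;> constructor <;> omega)
    (fun s hs t ht h => by split_ifs at h <;> omega) (fun s hs t ht h => by split_ifs at h <;> omega)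
    (fun s hs t ht h => by split_ifs at h <;> omega)
  have hlen2 : (2 :: g).length = t₀ + 1 := by rw [List.length_cons, hlen]
  rw [← hlen2] at hclean
  -- the points of the structure: the edge `{X s, X (s+1)}` and the arc `X i, …, X (i + 2 t₀ + 1)`
  have hmem : ∀ t ≤ t₀ + 1,
      X (if t = 0 then ι else i + (t - 1)) ∈ insert (X s) (insert (X (s + 1)) ((Finset.range (2 * t₀ + 2)).image
        (fun j => X (i + j)))) ∧
      X (if t = 0 then ι' else i + 2 * t₀ + 1 - (t - 1)) ∈ insert (X s) (insert (X (s + 1))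
        ((Finset.range (2 * t₀ + 2)).image (fun j => X (i + j)))) := by
    intro t ht
    cases t with
    | zero =>
      simp only [if_true]
      obtain rfl | rfl : ι = s ∨ ι = s + 1 := by omega
      · obtain rfl : ι' = ι + 1 := by omega
        exact ⟨Finset.mem_insert_self _ _, Finset.mem_insert_of_mem (Finset.mem_insert_self _ _)⟩
      · obtain rfl : ι' = s := by omega
        exact ⟨Finset.mem_insert_of_mem (Finset.mem_insert_self _ _), Finset.mem_insert_self _ _⟩
    | succ t =>
      rw [if_neg (by omega), if_neg (by omega), Nat.add_sub_cancel]
      refine ⟨Finset.mem_insert_of_mem (Finset.mem_insert_of_mem (Finset.mem_image.2 ⟨t, Finset.mem_range.2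
        (by omega), rfl⟩)), Finset.mem_insert_of_mem (Finset.mem_insert_of_mem (Finset.mem_image.2
        ⟨2 * t₀ + 1 - t, Finset.mem_range.2 (by omega), by rw [show i + (2 * t₀ + 1 - t) = i + 2 * t₀ + 1 - t by omega]⟩))⟩
  have hR : ∀ t ≤ (2 :: g).length,
      ((2 :: g).take t).foldl (fun v c => μ c v) (X ι) ∉ (insert (X s) (insert (X (s + 1))
        ((Finset.range (2 * t₀ + 2)).image (fun j => X (i + j)))))ᶜ ∧
      ((2 :: g).take t).foldl (fun v c => μ c v) (μ c (X ι)) ∉ (insert (X s) (insert (X (s + 1))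
        ((Finset.range (2 * t₀ + 2)).image (fun j => X (i + j)))))ᶜ := by
    intro t ht
    rw [hlen2] at ht
    rw [Finset.mem_compl, Finset.mem_compl, not_not, not_not, hP t ht, hQ t ht]
    exact hmem t ht
  obtain ⟨k, p, q, col, h1, h2x, h3, h4, h5, hk⟩ := cleanReflection_walk n μ hμ _ c (e (i + t₀)) (X ι) (2 :: g)
    (hfpf c (X ι)) hv hhead hlast (fun h => absurd h (List.cons_ne_nil _ _)) hinc hclean hR
  simp only [Finset.mem_compl, not_not] at h5
  exact ⟨k, p, q, col, h1, h2x, h3, h4, h5, by rw [hk, hlen2]; ring⟩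

/-- An offset `d < T` realising any residue: `(s + d) % T = j % T`. -/
theorem exists_offset {T : ℕ} (hT0 : 0 < T) (s j : ℕ) : ∃ d, d < T ∧ (s + d) % T = j % T := by
  refine ⟨(j % T + T - s % T) % T, Nat.mod_lt _ hT0, ?_⟩
  have hs := Nat.mod_lt s hT0
  rw [Nat.add_mod, Nat.mod_mod, Nat.add_mod_mod, show s % T + (j % T + T - s % T) = j % T + T by omega,
    Nat.add_mod_right, Nat.mod_mod]
end ThinWalk

open ThinWalk in
/-- **Registered form** (`stub_arcReflectionWalk`, a `--supports` helper of crux stmt-MatrixMultiplication-10883):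
`ThinWalk.shapeI` fully quantified — on the alternating frame walk `X` with least period `T`, a colour `c ≠ e i`
pairing `X i` with `X (i + 2t₀ + 1)`, `2t₀ + 1 < T`, yields clean closed-rung-walk data in the conclusion format of
the open core `stub_poorRigidCore` (no forbidden set) with `k + 1 = 2t₀ + 2` rungs. [this line; folklore] -/
theorem stub_arcReflectionWalk : ∀ (n : ℕ) (μ : Fin 3 → Equiv.Perm (Fin n)), (∀ i, μ i * μ i = 1 ∧ ∀ v, μ i v ≠ v) → ∀ (e : ℕ → Fin 3), (∀ t, (e t).val = t % 2) → ∀ (X : ℕ → Fin n) (T : ℕ), (∀ t, X (t + 1) = μ (e t) (X t)) → 0 < T → X T = X 0 → (∀ t, 0 < t → X t = X 0 → T ≤ t) → ∀ (i t₀ : ℕ) (c : Fin 3), c ≠ e i → μ c (X i) = X (i + 2 * t₀ + 1) → 2 * t₀ + 1 < T → ∃ (k : ℕ) (p q : Fin (k + 1) → Fin n) (col : Fin (k + 1) → Fin 3), (∀ i, p i ≠ q i) ∧ (∀ i, (μ (col i) (p i) = p (i + 1) ∧ μ (col i) (q i) = q (i + 1)) ∨ (μ (col i) (p i) = q (i +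 1) ∧ μ (col i) (q i) = p (i + 1))) ∧ (∀ i, col i ≠ col (i + 1)) ∧ (∀ i j, (p i = p j ∧ q i = q j) ∨ (p i = q j ∧ q i = p j) ∨ (p i ≠ p j ∧ p i ≠ q j ∧ q i ≠ p j ∧ q i ≠ q j)) ∧ k + 1 = 2 * t₀ + 2 :=
  fun _ μ hμ e he X T hX hT0 hTX hTmin i t₀ c hc hci hw =>
    let ⟨k, p, q, col, h1, h2, h3, h4, _, hk⟩ :=
      shapeI μ e X T (fun c => (hμ c).1) (fun c => (hμ c).2) he hX hT0 hTX hTmin i t₀ c hc hci hw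
    ⟨k, p, q, col, h1, h2, h3, h4, hk⟩

end Summit.MatrixMultiplication.MatrixMultiplication.Theorems.HyperoctahedralThreshold
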